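import Mathlib
import Literature.AlgebraicGeometry.Resolution.CobordantGame
import Literature.AlgebraicGeometry.Resolution.FormalCoordinateChange
import Literature.AlgebraicGeometry.Resolution.CobordantChartCoefficients
import Summits.ResolutionOfSingularities.ResolutionOfSingularities.Theorems.WeightedInvariantGlobalizeLocalDropCanonize
import Summits.ResolutionOfSingularities.ResolutionOfSingularities.Theorems.WeightedInvariantGlobalizeLocalDropCylinder
import Summits.ResolutionOfSingularities.ResolutionOfSingularities.Theorems.WeightedInvariantGlobalizeLocalDropRegularGerms

/-!
# `WeightedInvariant.LocalWeightedDrop`, line `hasse-ridge-face-selection`: the hyperbolic lift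

Crux item stmt-ResolutionOfSingularities-8899 (route `ResolutionOfSingularities/WeightedInvariant`),
skeleton v4 of the line `hasse-ridge-face-selection`, stub `stub_hyperbolicLift`: in the inductive form
of the crux (`Literature.….CobordantGame`) a formal Morse lemma puts a germ whose tangent quadric has a
hyperbolic pair in the shape `x₀·x₁ + H(x₂, …)`, and THIS file lifts a winning strategy of `H` to
`x₀·x₁ + H` — `Won k n h → Won k (n+2) (X 0 * X 1 + rename (Fin.addNatEmb 2) h)` over every field.

Proof (strategy copying, cf. the cylinders of `WeightedInvariantGlobalizeLocalDropCylinder.lean`).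
Internally the pair sits in the LAST two slots, `x_n·x_{n+1} + h(x₀, …, x_{n-1})` — a shape that
reproduces itself on successors (`HyperbolicLift.wonBy_lift`); the registered spelling is reached at the
end by a permutation of the slots (`HyperbolicLift.won_registered`).  The `WonBy α` version is proved for
ALL `h` by transfinite induction on `α`.  For `h = 0`, `x_n x_{n+1}` is won outright by the divisorial
move `w = e_n` (`HyperbolicLift.wonBy_zero_X_mul_X`).  For `h ≠ 0` a winning move `(Φ, w)` of `h` is
mirrored as `Θ = (Φ, x_n, x_{n+1})` with weights `(w, D, 0)`, `D = ord_w (h∘Φ)`; its transform at an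
exceptional point `c` is `s^D·(γ + y_{n+1})·y_{n+2} + (transform of h at c|_{<n})`, `γ = c_n`
(`HyperbolicLift.transform_eq`), and the `h`-part is `s^D · G` with `s ∤ G` at EVERY point
(`CobordantChart.eq_weightedOrder_of_factor`).  By uniqueness of the `s`-adic factorisation every
`s`-saturated successor is `g = (γ + y_{n+1})·y_{n+2} + G`; `g ∈ 𝔪²` forces `γ = 0` and `G ∈ 𝔪²`, so `G`
is a singular successor of `h`, won with a smaller value, and `g = y_{n+1}·y_{n+2} + G` is won by induction.
Deliberately NOT here: the formal Morse splitting and the tangent-quadric dichotomy that produce the shape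
`x₀x₁ + H` (the neighbouring stubs of the skeleton), and any statement about game values beyond `Won`.
-/

set_option linter.dupNamespace false -- mandated namespace of this single-conjunct summit

namespace Summit.ResolutionOfSingularities.ResolutionOfSingularities.Theorems

open Literature.AlgebraicGeometry.Resolution
open Literature.AlgebraicGeometry.Resolution.CobordantGame

namespace HyperbolicLift

variable {k : Type} [Field k] {n : ℕ}

/-! ### 1. The lifted move `Θ = (Φ, x_n, x_{n+1})` (first slots via `Fin.castSuccEmb.trans Fin.castSuccEmb`),
weights `W = (w, D, 0)`, and the transform of the lift `x_n x_{n+1} + h` -/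

section LiftMove

variable {Φ : Fin n → MvPowerSeries (Fin n) k} {D : ℕ} {w : Fin n → ℕ}
  {Θ : Fin (n + 1 + 1) → MvPowerSeries (Fin (n + 1 + 1)) k} {W : Fin (n + 1 + 1) → ℕ}
  (hΘ : Θ = Fin.snoc (α := fun _ => MvPowerSeries (Fin (n + 1 + 1)) k)
    (Fin.snoc (α := fun _ => MvPowerSeries (Fin (n + 1 + 1)) k)
      (fun m => MvPowerSeries.rename (Fin.castSuccEmb.trans Fin.castSuccEmb) (Φ m))
      (MvPowerSeries.X (Fin.last n).castSucc)) (MvPowerSeries.X (Fin.last (n + 1))))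
  (hW : W = Fin.snoc (α := fun _ => ℕ) (Fin.snoc (α := fun _ => ℕ) w D) 0)

include hΘ

/-- The lifted coordinate change has zero constant terms. -/
theorem constantCoeff_liftMove (hΦ0 : ∀ i, MvPowerSeries.constantCoeff (Φ i) = 0) (i : Fin (n + 1 + 1)) :
    MvPowerSeries.constantCoeff (Θ i) = 0 := by
  subst hΘ
  refine Fin.lastCases ?_ (fun j => ?_) i
  · rw [Fin.snoc_last]
    exact MvPowerSeries.constantCoeff_X _
  refine Fin.lastCases ?_ (fun m => ?_) j
  · rw [Fin.snoc_castSucc, Fin.snoc_last]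
    exact MvPowerSeries.constantCoeff_X _
  · rw [Fin.snoc_castSucc, Fin.snoc_castSucc, MvPowerSeries.constantCoeff_rename]
    exact hΦ0 m

/-- `Θ^*` of a renamed series is the renamed `Φ^*`. -/
theorem subst_liftMove_rename (hΦ0 : ∀ i, MvPowerSeries.constantCoeff (Φ i) = 0)
    (F : MvPowerSeries (Fin n) k) :
    MvPowerSeries.subst Θ (MvPowerSeries.rename (Fin.castSuccEmb.trans Fin.castSuccEmb) F) =
      MvPowerSeries.rename (Fin.castSuccEmb.trans Fin.castSuccEmb) (MvPowerSeries.subst Φ F) := by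
  rw [subst_rename_eq _ _ (constantCoeff_liftMove hΘ hΦ0) F, rename_subst_eq _ Φ hΦ0 F, hΘ]
  congr 1
  funext m
  show Fin.snoc _ _ (Fin.castSucc (Fin.castSucc m)) = _
  rw [Fin.snoc_castSucc, Fin.snoc_castSucc]

/-- The lifted coordinate change has invertible linear part (it has the compositional right inverse
`(Φ⁻¹, x_n, x_{n+1})`). -/
theorem isUnit_det_linMat_liftMove (hΦ0 : ∀ i, MvPowerSeries.constantCoeff (Φ i) = 0)
    (hdet : IsUnit (FormalCoordChange.linMat Φ).det) : IsUnit (FormalCoordChange.linMat Θ).det := by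
  obtain ⟨Ψ, -, -, hΦΨ⟩ := FormalCoordChange.exists_comp_inverse hΦ0 hdet
  have hs := MvPowerSeries.hasSubst_of_constantCoeff_zero (constantCoeff_liftMove hΘ hΦ0)
  refine isUnit_det_linMat_of_comp_eq_X (φ := Fin.snoc (α := fun _ => MvPowerSeries (Fin (n + 1 + 1)) k)
    (Fin.snoc (α := fun _ => MvPowerSeries (Fin (n + 1 + 1)) k)
      (fun m => MvPowerSeries.rename (Fin.castSuccEmb.trans Fin.castSuccEmb) (Ψ m))
      (MvPowerSeries.X (Fin.last n).castSucc)) (MvPowerSeries.X (Fin.last (n + 1))))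
    (constantCoeff_liftMove hΘ hΦ0) fun s => ?_
  refine Fin.lastCases ?_ (fun j => ?_) s
  · rw [Fin.snoc_last, MvPowerSeries.subst_X hs, hΘ, Fin.snoc_last]
  refine Fin.lastCases ?_ (fun m => ?_) j
  · rw [Fin.snoc_castSucc, Fin.snoc_last, MvPowerSeries.subst_X hs, hΘ, Fin.snoc_castSucc, Fin.snoc_last]
  · rw [Fin.snoc_castSucc, Fin.snoc_castSucc, subst_liftMove_rename hΘ hΦ0, hΦΨ, MvPowerSeries.rename_X]
    rfl

include hW

/-- THE LIFTED MOVE IS LEGAL (for any `D`). -/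
theorem isMove_liftMove (hm : IsMove k Φ w) : IsMove k Θ W := by
  obtain ⟨hΦ0, hdet, i₀, hi₀⟩ := hm
  refine ⟨constantCoeff_liftMove hΘ hΦ0, isUnit_det_linMat_liftMove hΘ hΦ0 hdet, i₀.castSucc.castSucc, ?_⟩
  rwa [hW, Fin.snoc_castSucc, Fin.snoc_castSucc]

omit hΘ in
/-- First slots of the chart of the lifted weights: the chart of `w` at the projected point, renamed. -/
theorem cruxChart_liftWeight_cc (c : Fin (n + 1 + 1) → k) (m : Fin n) :
    cruxChart k W c ((Fin.castSuccEmb.trans Fin.castSuccEmb) m) =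
      MvPowerSeries.rename (Fin.castSuccEmb.trans Fin.castSuccEmb)
        (cruxChart k w (fun m => c ((Fin.castSuccEmb.trans Fin.castSuccEmb) m)) m) := by
  unfold cruxChart
  rw [show W ((Fin.castSuccEmb.trans Fin.castSuccEmb) m) = w m by
    rw [hW]; show Fin.snoc _ _ (Fin.castSucc (Fin.castSucc m)) = _; rw [Fin.snoc_castSucc, Fin.snoc_castSucc]]
  split_ifs with hw
  · rw [map_mul, map_pow, map_add, MvPowerSeries.rename_X, MvPowerSeries.rename_C,
      MvPowerSeries.rename_X]
    rfl
  · rw [MvPowerSeries.rename_X]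
    rfl

/-- THE TRANSFORM OF THE LIFT at the exceptional point `c`:
`s^D · (γ + y_{n+1}) · y_{n+2} + rename (transform of h under (Φ, w) at c|_{<n})`, `γ = c_n` (`0` if `D = 0`). -/
theorem transform_eq (hΦ0 : ∀ i, MvPowerSeries.constantCoeff (Φ i) = 0) (c : Fin (n + 1 + 1) → k)
    (h : MvPowerSeries (Fin n) k) :
    MvPowerSeries.subst (cruxChart k W c) (MvPowerSeries.subst Θ
        (MvPowerSeries.X (Fin.last n).castSucc * MvPowerSeries.X (Fin.last (n + 1)) +
          MvPowerSeries.rename (Fin.castSuccEmb.trans Fin.castSuccEmb) h)) =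
      MvPowerSeries.X 0 ^ D * ((MvPowerSeries.C (if 0 < D then c (Fin.last n).castSucc else 0) +
          MvPowerSeries.X (Fin.last (n + 1)).castSucc) * MvPowerSeries.X (Fin.last (n + 1 + 1))) +
        MvPowerSeries.rename (Fin.castSuccEmb.trans Fin.castSuccEmb) (MvPowerSeries.subst
          (cruxChart k w fun m => c ((Fin.castSuccEmb.trans Fin.castSuccEmb) m)) (MvPowerSeries.subst Φ h)) := by
  have hΘs := MvPowerSeries.hasSubst_of_constantCoeff_zero (constantCoeff_liftMove hΘ hΦ0)
  have hc0 := constantCoeff_cruxChart (k := k) W c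
  have hs := MvPowerSeries.hasSubst_of_constantCoeff_zero hc0
  have ha : cruxChart k W c (Fin.last n).castSucc = MvPowerSeries.X 0 ^ D *
      (MvPowerSeries.C (if 0 < D then c (Fin.last n).castSucc else 0) +
        MvPowerSeries.X (Fin.last (n + 1)).castSucc) := by
    unfold cruxChart
    rw [hW, Fin.snoc_castSucc, Fin.snoc_last]
    split_ifs with hD
    · rfl
    · rw [show D = 0 by omega, pow_zero, one_mul, map_zero, zero_add]
      rfl
  have hb : cruxChart k W c (Fin.last (n + 1)) = MvPowerSeries.X (Fin.last (n + 1 + 1)) := by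
    unfold cruxChart
    rw [hW, Fin.snoc_last, if_neg (lt_irrefl 0)]
    rfl
  rw [MvPowerSeries.subst_add hΘs, MvPowerSeries.subst_mul hΘs, MvPowerSeries.subst_X hΘs,
    MvPowerSeries.subst_X hΘs, subst_liftMove_rename hΘ hΦ0, hΘ, Fin.snoc_castSucc, Fin.snoc_last,
    Fin.snoc_last, MvPowerSeries.subst_add hs, MvPowerSeries.subst_mul hs, MvPowerSeries.subst_X hs,
    MvPowerSeries.subst_X hs, ha, hb, subst_rename_eq _ _ hc0, rename_subst_eq _ _ (constantCoeff_cruxChart w _)]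
  simp only [cruxChart_liftWeight_cc hW]
  ring

end LiftMove

/-! ### 2. The `s`-saturated successor `g = (γ + y_{n+1})·y_{n+2} + G` (in `n + 3` variables) -/

section Successor

variable (γ : k) (G : MvPowerSeries (Fin (n + 1)) k) {g : MvPowerSeries (Fin (n + 1 + 1 + 1)) k}
  (hg : g = (MvPowerSeries.C γ + MvPowerSeries.X (Fin.last (n + 1)).castSucc) *
      MvPowerSeries.X (Fin.last (n + 1 + 1)) + MvPowerSeries.rename (Fin.castSuccEmb.trans Fin.castSuccEmb) G)

/-- The renamed slots avoid `y_{n+2}`. -/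
theorem cc_ne_last (j : Fin (n + 1)) :
    ((Fin.castSuccEmb.trans Fin.castSuccEmb) j : Fin (n + 1 + 1 + 1)) ≠ Fin.last (n + 1 + 1) :=
  (Fin.castSucc_lt_last _).ne

/-- Coefficients of the renamed `G` vanish at exponents involving `y_{n+2}`. -/
theorem coeff_rename_cc_eq_zero {d : Fin (n + 1 + 1 + 1) →₀ ℕ} (hd : d (Fin.last (n + 1 + 1)) ≠ 0) :
    MvPowerSeries.coeff d (MvPowerSeries.rename (Fin.castSuccEmb.trans Fin.castSuccEmb) G :
      MvPowerSeries (Fin (n + 1 + 1 + 1)) k) = 0 := by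
  apply MvPowerSeries.coeff_rename_eq_zero
  rintro ⟨u, rfl⟩
  exact hd (Finsupp.mapDomain_notin_range u _ fun ⟨j, hj⟩ => cc_ne_last j hj)

include hg

/-- `s ∤ g`: the monomial `y_{n+1} y_{n+2}` of `g` survives. -/
theorem not_X_dvd_g : ¬ MvPowerSeries.X 0 ∣ g := by
  intro h
  have h0a : (0 : Fin (n + 1 + 1 + 1)) ≠ (Fin.last (n + 1)).castSucc := fun h => by
    simpa using congrArg Fin.val h
  have h0b : (0 : Fin (n + 1 + 1 + 1)) ≠ Fin.last (n + 1 + 1) := fun h => by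
    simpa using congrArg Fin.val h
  have h1 := (MvPowerSeries.X_dvd_iff).mp h
    (Finsupp.single (Fin.last (n + 1)).castSucc 1 + Finsupp.single (Fin.last (n + 1 + 1)) 1) (by
      rw [Finsupp.add_apply, Finsupp.single_apply, Finsupp.single_apply, if_neg h0a.symm,
        if_neg h0b.symm]; rfl)
  rw [hg, map_add, coeff_rename_cc_eq_zero G (by rw [Finsupp.add_apply, Finsupp.single_eq_same]; omega),
    add_zero, MvPowerSeries.X_def (Fin.last (n + 1 + 1)), MvPowerSeries.coeff_add_mul_monomial, mul_one,
    map_add, MvPowerSeries.coeff_C, if_neg (Finsupp.single_ne_zero.mpr one_ne_zero),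
    MvPowerSeries.coeff_index_single_self_X, zero_add] at h1
  exact one_ne_zero h1

/-- The linear coefficient of `g` at `y_{n+2}` is `γ`. -/
theorem coeff_single_last_g : MvPowerSeries.coeff (Finsupp.single (Fin.last (n + 1 + 1)) 1) g = γ := by
  rw [hg, map_add, coeff_rename_cc_eq_zero G (by rw [Finsupp.single_eq_same]; exact one_ne_zero), add_zero,
    MvPowerSeries.X_def (Fin.last (n + 1 + 1)), MvPowerSeries.coeff_mul_monomial, if_pos le_rfl, tsub_self,
    mul_one, map_add, MvPowerSeries.coeff_zero_C, MvPowerSeries.coeff_zero_X, add_zero]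

/-- SINGULARITY DESCENDS: if `g = (γ + y_{n+1})·y_{n+2} + G` is in `𝔪²` then `γ = 0` and `G ∈ 𝔪²`. -/
theorem singular_of_singular_g
    (hs : MvPowerSeries.constantCoeff g = 0 ∧ ∀ j, MvPowerSeries.coeff (Finsupp.single j 1) g = 0) :
    γ = 0 ∧ (MvPowerSeries.constantCoeff G = 0 ∧ ∀ j, MvPowerSeries.coeff (Finsupp.single j 1) G = 0) := by
  obtain ⟨h0, h1⟩ := hs
  refine ⟨?_, ?_, fun j => ?_⟩
  · rw [← coeff_single_last_g γ G hg]
    exact h1 _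
  · rw [hg, map_add, MvPowerSeries.constantCoeff_rename, map_mul, MvPowerSeries.constantCoeff_X, mul_zero,
      zero_add] at h0
    exact h0
  · have := h1 ((Fin.castSuccEmb.trans Fin.castSuccEmb) j)
    rw [hg, map_add, MvPowerSeries.X_def (Fin.last (n + 1 + 1)), MvPowerSeries.coeff_mul_monomial,
      if_neg (by rw [Finsupp.single_le_iff, Finsupp.single_apply, if_neg (cc_ne_last j)]; omega), zero_add,
      ← Finsupp.embDomain_single, MvPowerSeries.coeff_embDomain_rename] at this
    exact this

end Successor

/-! ### 3. The `s`-order of the `h`-part; the case `h = 0` -/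

/-- At EVERY exceptional point `c` the transform of `H ≠ 0` under the chart of `w` factors as `s^D · G`,
`s ∤ G`, with the SAME `D`, the `w`-order of `H` (`CobordantChart.eq_weightedOrder_of_factor`). -/
theorem exists_factor (w : Fin n → ℕ) (c : Fin n → k) {H : MvPowerSeries (Fin n) k} (hH : H ≠ 0)
    {D : ℕ} (hD : (D : ℕ∞) = H.weightedOrder w) : ∃ G : MvPowerSeries (Fin (n + 1)) k,
      MvPowerSeries.subst (cruxChart k w c) H = MvPowerSeries.X 0 ^ D * G ∧ ¬ MvPowerSeries.X 0 ∣ G := by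
  set c' : Fin n → k := fun i => if 0 < w i then c i else 0 with hc'def
  have hc' : ∀ i, w i = 0 → c' i = 0 := fun i hi => by simp [hc'def, hi]
  have hcc : cruxChart k w c = CobordantChart.chart w c' := CobordantChart.cruxChart_eq_chart w c
  rw [hcc]
  obtain ⟨a, G, hfac, hG⟩ := exists_eq_X_pow_mul_not_dvd 0 (CobordantChart.subst_chart_ne_zero w c' hc' hH)
  have ha := CobordantChart.eq_weightedOrder_of_factor w c' hc' hH hfac hG
  rw [← hD, Nat.cast_inj] at ha
  exact ⟨G, ha ▸ hfac, hG⟩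

/-- THE CASE `h = 0`: `x_n x_{n+1}` is won with value `0` by the divisorial move `θ = id`, `w = e_n` (an
exceptional point off the vertex has `c_n ≠ 0`, and then the successor `(c_n + y_{n+1})·y_{n+2}` has a
linear term). -/
theorem wonBy_zero_X_mul_X (n : ℕ) : WonBy k 0 (n + 1 + 1)
    (MvPowerSeries.X (Fin.last n).castSucc * MvPowerSeries.X (Fin.last (n + 1)) :
      MvPowerSeries (Fin (n + 1 + 1)) k) := by
  rw [wonBy_zero_iff]
  refine ⟨MvPowerSeries.X, Pi.single (Fin.last n).castSucc 1, isMove_X_single _, fun g hg => ?_⟩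
  obtain ⟨c, a, ⟨i, hwi, hci⟩, hfac, hndvd, -, h1⟩ := hg
  have hi : i = (Fin.last n).castSucc := by
    by_contra hne
    rw [Pi.single_eq_of_ne hne] at hwi
    exact lt_irrefl 0 hwi
  subst hi
  have hcs := MvPowerSeries.hasSubst_of_constantCoeff_zero
    (constantCoeff_cruxChart (k := k) (Pi.single (Fin.last n).castSucc 1) c)
  rw [MvPowerSeries.subst_self, id, MvPowerSeries.subst_mul hcs, MvPowerSeries.subst_X hcs,
    MvPowerSeries.subst_X hcs] at hfac
  have key : cruxChart k (Pi.single (Fin.last n).castSucc 1) c (Fin.last n).castSucc *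
      cruxChart k (Pi.single (Fin.last n).castSucc 1) c (Fin.last (n + 1)) =
      MvPowerSeries.X 0 ^ 1 * ((MvPowerSeries.C (c (Fin.last n).castSucc) +
        MvPowerSeries.X (Fin.last (n + 1)).castSucc) * MvPowerSeries.X (Fin.last (n + 1 + 1)) +
          MvPowerSeries.rename (Fin.castSuccEmb.trans Fin.castSuccEmb) (0 : MvPowerSeries (Fin (n + 1)) k)) := by
    unfold cruxChart
    rw [if_pos (by simp), Pi.single_eq_same, if_neg (by
      rw [Pi.single_eq_of_ne (Fin.castSucc_lt_last _).ne']; exact lt_irrefl 0), pow_one, map_zero,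
      add_zero, mul_assoc]
    rfl
  rw [key] at hfac
  obtain ⟨-, hg⟩ := X_pow_mul_eq_X_pow_mul 0 hfac (not_X_dvd_g _ 0 rfl) hndvd
  subst hg
  have := h1 (Fin.last (n + 1 + 1))
  rw [coeff_single_last_g _ 0 rfl] at this
  exact hci this

/-! ### 4. The hyperbolic lift of the game values, and the registered spelling -/

/-- HYPERBOLIC LIFT OF THE GAME VALUES: `WonBy α n h → WonBy α (n+2) (x_n x_{n+1} + h)` (strategy copying,
transfinite induction on `α`, for all `h`; the pair in the last two slots). -/
theorem wonBy_lift {α : Ordinal.{0}} : ∀ {n : ℕ} {h : MvPowerSeries (Fin n) k}, WonBy k α n h →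
    WonBy k α (n + 1 + 1) (MvPowerSeries.X (Fin.last n).castSucc * MvPowerSeries.X (Fin.last (n + 1)) +
      MvPowerSeries.rename (Fin.castSuccEmb.trans Fin.castSuccEmb) h) := by
  induction α using WellFoundedLT.induction with
  | ind α ih =>
    intro n h hW
    by_cases hz : h = 0
    · subst hz
      rw [map_zero, add_zero]
      exact (wonBy_zero_X_mul_X n).mono zero_le
    rw [wonBy_iff] at hW
    obtain ⟨Φ, w, hm, hs⟩ := hW
    have hH : MvPowerSeries.subst Φ h ≠ 0 := FormalCoordChange.subst_ne_zero_of_isUnit_det hm.1 hm.2.1 hz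
    obtain ⟨D, hD⟩ : ∃ D : ℕ, (D : ℕ∞) = (MvPowerSeries.subst Φ h).weightedOrder w :=
      ⟨_, (MvPowerSeries.ne_zero_iff_weightedOrder_finite w).mp hH⟩
    set Θ : Fin (n + 1 + 1) → MvPowerSeries (Fin (n + 1 + 1)) k :=
      Fin.snoc (α := fun _ => MvPowerSeries (Fin (n + 1 + 1)) k)
        (Fin.snoc (α := fun _ => MvPowerSeries (Fin (n + 1 + 1)) k)
          (fun m => MvPowerSeries.rename (Fin.castSuccEmb.trans Fin.castSuccEmb) (Φ m))
          (MvPowerSeries.X (Fin.last n).castSucc)) (MvPowerSeries.X (Fin.last (n + 1))) with hΘ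
    set W : Fin (n + 1 + 1) → ℕ := Fin.snoc (α := fun _ => ℕ) (Fin.snoc (α := fun _ => ℕ) w D) 0 with hW
    rw [wonBy_iff]
    refine ⟨Θ, W, isMove_liftMove hΘ hW hm, fun g' hg' => ?_⟩
    obtain ⟨c, a', hoff', hfac', hndvd', hsing'⟩ := hg'
    rw [transform_eq hΘ hW hm.1 c h] at hfac'
    set γ : k := (if 0 < D then c (Fin.last n).castSucc else 0) with hγ
    -- the `h`-part of the transform is `s^D · G`, `s ∤ G`, at the projected point `c|_{<n}`
    obtain ⟨G, hTfac, hG⟩ := exists_factor w (fun m => c ((Fin.castSuccEmb.trans Fin.castSuccEmb) m)) hH hD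
    -- uniqueness of the `s`-adic factorisation: `g' = (γ + y_{n+1})·y_{n+2} + G`
    have hι0 : ((Fin.castSuccEmb.trans Fin.castSuccEmb : Fin (n + 1) ↪ Fin (n + 1 + 1 + 1)) 0) = 0 := rfl
    rw [hTfac, map_mul, map_pow, MvPowerSeries.rename_X, hι0, ← mul_add] at hfac'
    obtain ⟨-, hgg'⟩ := X_pow_mul_eq_X_pow_mul 0 hfac' (not_X_dvd_g γ G rfl) hndvd'
    subst hgg'
    obtain ⟨hγ0, hGsing⟩ := singular_of_singular_g γ G rfl hsing'
    -- the projected exceptional point is off the vertex of `w` (as `γ = 0`)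
    have hoff : ∃ i, 0 < w i ∧ (fun m => c ((Fin.castSuccEmb.trans Fin.castSuccEmb) m)) i ≠ 0 := by
      obtain ⟨i, hwi, hci⟩ := hoff'
      rw [hW] at hwi
      revert hwi hci
      refine Fin.lastCases ?_ (fun j => ?_) i
      · rw [Fin.snoc_last]
        exact fun hwi _ => absurd hwi (lt_irrefl 0)
      refine Fin.lastCases ?_ (fun m => ?_) j
      · rw [Fin.snoc_castSucc, Fin.snoc_last]
        intro hD0 hci
        rw [hγ, if_pos hD0] at hγ0
        exact absurd hγ0 hci
      · rw [Fin.snoc_castSucc, Fin.snoc_castSucc]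
        exact fun hwi hci => ⟨m, hwi, hci⟩
    -- `G` is a singular successor of `h`, won with a smaller value; lift it by induction
    obtain ⟨β, hβ, hWG⟩ := hs G ⟨_, D, hoff, hTfac, hG, hGsing⟩
    refine ⟨β, hβ, ?_⟩
    rw [hγ0, map_zero, zero_add]
    exact ih β hβ hWG

/-- THE REGISTERED SPELLING: the permutation of the slots `(0, …, n-1, n, n+1) ↦ (2, …, n+1, 0, 1)` (a legal
coordinate change, `won_subst_iff`) carries `x_n x_{n+1} + h(x₀, …)` to `x₀ x₁ + h(x₂, …)`. -/
theorem won_registered {h : MvPowerSeries (Fin n) k} (hW : Won k (n + 1 + 1)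
    (MvPowerSeries.X (Fin.last n).castSucc * MvPowerSeries.X (Fin.last (n + 1)) +
      MvPowerSeries.rename (Fin.castSuccEmb.trans Fin.castSuccEmb) h)) :
    Won k (n + 2) (MvPowerSeries.X 0 * MvPowerSeries.X 1 + MvPowerSeries.rename (Fin.addNatEmb 2) h) := by
  set φ : Fin (n + 2) → MvPowerSeries (Fin (n + 2)) k := fun i => MvPowerSeries.X
    (Fin.snoc (α := fun _ => Fin (n + 2)) (Fin.snoc (α := fun _ => Fin (n + 2))
      (fun m => Fin.addNatEmb 2 m) 0) 1 i) with hφ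
  have h0 : ∀ i, MvPowerSeries.constantCoeff (φ i) = 0 := fun i => MvPowerSeries.constantCoeff_X _
  have hs := MvPowerSeries.hasSubst_of_constantCoeff_zero h0
  have hdet : IsUnit (FormalCoordChange.linMat φ).det := by
    refine isUnit_det_linMat_of_comp_eq_X (φ := Fin.cons (MvPowerSeries.X (Fin.last n).castSucc)
      (Fin.cons (MvPowerSeries.X (Fin.last (n + 1))) fun m =>
        MvPowerSeries.X ((Fin.castSuccEmb.trans Fin.castSuccEmb) m))) h0 fun s => ?_
    refine Fin.cases ?_ (fun s => ?_) s
    · show MvPowerSeries.subst φ (MvPowerSeries.X (Fin.last n).castSucc) = _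
      rw [MvPowerSeries.subst_X hs, hφ]
      simp only [Fin.snoc_castSucc, Fin.snoc_last]
    refine Fin.cases ?_ (fun m => ?_) s
    · show MvPowerSeries.subst φ (MvPowerSeries.X (Fin.last (n + 1))) = _
      rw [MvPowerSeries.subst_X hs, hφ]
      simp only [Fin.snoc_last]
      rfl
    · show MvPowerSeries.subst φ (MvPowerSeries.X (Fin.castSucc (Fin.castSucc m))) = _
      rw [MvPowerSeries.subst_X hs, hφ]
      simp only [Fin.snoc_castSucc]
      rfl
  have key : MvPowerSeries.subst φ (MvPowerSeries.X (Fin.last n).castSucc * MvPowerSeries.X (Fin.last (n + 1)) +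
      MvPowerSeries.rename (Fin.castSuccEmb.trans Fin.castSuccEmb) h) =
      MvPowerSeries.X 0 * MvPowerSeries.X 1 + MvPowerSeries.rename (Fin.addNatEmb 2) h := by
    rw [MvPowerSeries.subst_add hs, MvPowerSeries.subst_mul hs, MvPowerSeries.subst_X hs,
      MvPowerSeries.subst_X hs, subst_rename_eq _ _ h0 h, MvPowerSeries.rename_eq_subst, hφ]
    simp only [Fin.snoc_castSucc, Fin.snoc_last, Function.Embedding.trans_apply, Fin.coe_castSuccEmb]
    rfl
  rw [← key]
  exact (won_subst_iff h0 hdet _).mpr hW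

end HyperbolicLift

/-- HYPERBOLIC LIFT (char-free, every field).  If `h ∈ k[[x₁,…,x_n]]` is in the winning region then so is
`x₀·x₁ + h` in `n + 2` variables (`h` renamed into the slots `2, …, n+1` by `Fin.addNatEmb 2 : m ↦ m + 2`).
Strategy copying (`HyperbolicLift.wonBy_lift`, with the pair in the last two slots; the slots are permuted
back in `HyperbolicLift.won_registered`): a winning move of `h` is mirrored with the identity on the
hyperbolic pair and the weights `(D, 0)` there, `D = ord_w (h∘Φ)`; an exceptional point with `c ≠ 0` on the
pair gives a linear term (no singular successor), and otherwise the `s`-saturated singular successors are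
exactly `y·y' + g_h` for the singular successors `g_h` of `h`, won by induction on the game value; for
`h = 0`, `x₀x₁` is won outright by a divisorial move. -/
theorem stub_hyperbolicLift : ∀ (k : Type) [Field k] (n : ℕ) (h : MvPowerSeries (Fin n) k),
    CobordantGame.Won k n h →
    CobordantGame.Won k (n + 2) (MvPowerSeries.X (0 : Fin (n + 2)) * MvPowerSeries.X (1 : Fin (n + 2)) +
      MvPowerSeries.rename (Fin.addNatEmb 2) h) := by
  intro k _ n h hW
  obtain ⟨α, hα⟩ := hW.exists_wonBy
  exact HyperbolicLift.won_registered (HyperbolicLift.wonBy_lift hα).won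

end Summit.ResolutionOfSingularities.ResolutionOfSingularities.Theorems
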